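import Summits.BirchSwinnertonDyer.Rank1Residual.GaloisImage.ThreeTorsionPairingDichotomy
import Mathlib.FieldTheory.Galois.Infinite
import HarnessLib

/-!
# Pair values of `E[3]` in the subgroup currency; the invariance-and-descent core
# (cell `b2b-bsdres`, team n1011, seat p02 gen 10 — row T-E3SYMP, file F2c; TOOL)

HONEST FRAMING (cell `b2b-bsdres`, run/shared/lean/b2b/bsd-rank1-residual/, verbatim in every
file): the goal of the cell is to DELETE the COMBINATION-SHAPED residual classes of the
Birch–Swinnerton-Dyer formula for ALL analytic-rank `≤ 1` elliptic curves over `ℚ` — "full BSD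
formula for every rank `≤ 1` curve in class `C`" assembled STRICTLY from published theorems — so
that the rank-`≤ 1` remainder becomes exactly the CONSTRUCTION-SHAPED classes, which are TYPED
(missing-input `Prop`s), NOT attempted. This is not "finishing BSD". Team n1011 (N10 / N11):
research route; no claim beyond the stated classes; labels UNCHANGED; nothing is booked. Theorems
only (no definition, no named fact).

## What this file proves

Book-keeping for file F3b (`ThreeCongruenceCubeLaw`), in the currency of the subgroup
`E[3] = WeierstrassCurve.geomTorsion W 3` (elements `P, Q`, abscissae
`xOf (W := W_{K̄}) (P : geomPoints W)`), for an elliptic curve `W/K`, `char K = 0`: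

* `three_smul_geomTorsion`, `xOf_coe_neg`, `xOf_coe_smul`, `smul_b₄`;
* the RELABELLED PAIR VALUES `B₁(Q,P) = B₁(P,Q) = B₁(−P,Q) = B₁(P,−Q)`, `B₁(P,P+Q) = B₂(P,Q)`,
  `B₁(P,P−Q) = B₃(P,Q)` (`pairValue_swap/negLeft/negRight/addRight/subRight`) and
  `σ • B₁(P,Q) = B₁(σP,σQ)` (`smul_pairValue`);
* `pairValue_facts` — under the normalisation (N) `e S T · B₁ = B₂` of the cube-root pairing
  (file F2b): on a basis `B₁ ≠ 0`, `B₂ = e·B₁`, `B₃ = e²·B₁`, `e ≠ 0`, `B₁³ = Δ` (file F1);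
* `exists_algebraMap_eq_of_moves` — a function of bases of `E′[3]` invariant under the five moves
  (file F3a `const_of_moves`) on which `Γ_K` acts through the points takes its values in `K`
  (`InfiniteGalois.mem_range_algebraMap_iff_fixed`); `basis_map` — additive isomorphisms carry
  bases to bases.

References (context): Silverman *AEC* III.8; Serre 1972 §5.3.
-/

noncomputable section

open scoped Classical

open WeierstrassCurve WeierstrassCurve.Affine.Point Literature.NumberTheory.EllipticCurves

namespace Summit.BirchSwinnertonDyer.Rank1Residual.GaloisImage.CubeRootPairing

universe u

variable {K : Type u} [Field K] [CharZero K]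

/-! ### §4. `E[3]` in the subgroup currency (relabelled pair values, Galois action, facts from (N)) -/

section Relabel

variable (W : WeierstrassCurve K) [W.IsElliptic]

omit [CharZero K] [W.IsElliptic] in
/-- Every element of `E[3]` is killed by `3`. [folklore] -/
theorem three_smul_geomTorsion (P : geomTorsion W 3) : (3 : ℤ) • P = 0 :=
  Subtype.ext ((Submodule.mem_torsionBy_iff _ _).mp P.2)

omit [CharZero K] [W.IsElliptic] in
/-- `x(−P) = x(P)` on `E[3]`. [folklore] -/
theorem xOf_coe_neg (P : geomTorsion W 3) :
    xOf (W := W.baseChange (AlgebraicClosure K)) ((-P : geomTorsion W 3) : geomPoints W) = xOf (W := W.baseChange (AlgebraicClosure K)) ((P : geomTorsion W 3) : geomPoints W) :=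
  xOf_neg (W := W.baseChange (AlgebraicClosure K)) _

omit [CharZero K] [W.IsElliptic] in
/-- `x(σP) = σ x(P)` on `E[3]`. [folklore] -/
theorem xOf_coe_smul (σ : Field.absoluteGaloisGroup K) (P : geomTorsion W 3) :
    xOf (W := W.baseChange (AlgebraicClosure K)) ((σ • P : geomTorsion W 3) : geomPoints W) = σ • xOf (W := W.baseChange (AlgebraicClosure K)) ((P : geomTorsion W 3) : geomPoints W) :=
  xOf_smul W (Field.absoluteGaloisGroup.toAlgEquiv K σ) _

omit [CharZero K] [W.IsElliptic] in
/-- `σ b₄ = b₄`. [folklore] -/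
theorem smul_b₄ (σ : Field.absoluteGaloisGroup K) :
    σ • (W.baseChange (AlgebraicClosure K)).b₄ = (W.baseChange (AlgebraicClosure K)).b₄ :=
  algEquiv_b₄ W (Field.absoluteGaloisGroup.toAlgEquiv K σ)

omit [CharZero K] [W.IsElliptic] in
/-- Relabelling `(Q, P)`: `B₁(Q,P) = B₁(P,Q)`. [folklore] -/
theorem pairValue_swap (P Q : geomTorsion W 3) : ((W.baseChange (AlgebraicClosure K)).b₄ -
          3 * (xOf (W := W.baseChange (AlgebraicClosure K)) ((Q : geomTorsion W 3) : geomPoints W) *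
              xOf (W := W.baseChange (AlgebraicClosure K)) ((P : geomTorsion W 3) : geomPoints W) +
            xOf (W := W.baseChange (AlgebraicClosure K)) ((Q + P : geomTorsion W 3) : geomPoints W) *
              xOf (W := W.baseChange (AlgebraicClosure K)) ((Q - P : geomTorsion W 3) : geomPoints W))) = ((W.baseChange (AlgebraicClosure K)).b₄ -
          3 * (xOf (W := W.baseChange (AlgebraicClosure K)) ((P : geomTorsion W 3) : geomPoints W) *
              xOf (W := W.baseChange (AlgebraicClosure K)) ((Q : geomTorsion W 3) : geomPoints W) +
            xOf (W := W.baseChange (AlgebraicClosure K)) ((P + Q : geomTorsion W 3) : geomPoints W) *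
              xOf (W := W.baseChange (AlgebraicClosure K)) ((P - Q : geomTorsion W 3) : geomPoints W))) := by
  rw [add_comm Q P, show Q - P = -(P - Q) by abel, xOf_coe_neg]
  ring

omit [CharZero K] [W.IsElliptic] in
/-- Relabelling `(−P, Q)`: `B₁(−P,Q) = B₁(P,Q)`. [folklore] -/
theorem pairValue_negLeft (P Q : geomTorsion W 3) : ((W.baseChange (AlgebraicClosure K)).b₄ -
          3 * (xOf (W := W.baseChange (AlgebraicClosure K)) ((-P : geomTorsion W 3) : geomPoints W) *
              xOf (W := W.baseChange (AlgebraicClosure K)) ((Q : geomTorsion W 3) : geomPoints W) +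
            xOf (W := W.baseChange (AlgebraicClosure K)) ((-P + Q : geomTorsion W 3) : geomPoints W) *
              xOf (W := W.baseChange (AlgebraicClosure K)) ((-P - Q : geomTorsion W 3) : geomPoints W))) = ((W.baseChange (AlgebraicClosure K)).b₄ -
          3 * (xOf (W := W.baseChange (AlgebraicClosure K)) ((P : geomTorsion W 3) : geomPoints W) *
              xOf (W := W.baseChange (AlgebraicClosure K)) ((Q : geomTorsion W 3) : geomPoints W) +
            xOf (W := W.baseChange (AlgebraicClosure K)) ((P + Q : geomTorsion W 3) : geomPoints W) *
              xOf (W := W.baseChange (AlgebraicClosure K)) ((P - Q : geomTorsion W 3) : geomPoints W))) := by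
  rw [show -P + Q = -(P - Q) by abel, show -P - Q = -(P + Q) by abel, xOf_coe_neg, xOf_coe_neg,
    xOf_coe_neg]
  ring

omit [CharZero K] [W.IsElliptic] in
/-- Relabelling `(P, −Q)`: `B₁(P,−Q) = B₁(P,Q)`. [folklore] -/
theorem pairValue_negRight (P Q : geomTorsion W 3) : ((W.baseChange (AlgebraicClosure K)).b₄ -
          3 * (xOf (W := W.baseChange (AlgebraicClosure K)) ((P : geomTorsion W 3) : geomPoints W) *
              xOf (W := W.baseChange (AlgebraicClosure K)) ((-Q : geomTorsion W 3) : geomPoints W) +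
            xOf (W := W.baseChange (AlgebraicClosure K)) ((P + -Q : geomTorsion W 3) : geomPoints W) *
              xOf (W := W.baseChange (AlgebraicClosure K)) ((P - -Q : geomTorsion W 3) : geomPoints W))) = ((W.baseChange (AlgebraicClosure K)).b₄ -
          3 * (xOf (W := W.baseChange (AlgebraicClosure K)) ((P : geomTorsion W 3) : geomPoints W) *
              xOf (W := W.baseChange (AlgebraicClosure K)) ((Q : geomTorsion W 3) : geomPoints W) +
            xOf (W := W.baseChange (AlgebraicClosure K)) ((P + Q : geomTorsion W 3) : geomPoints W) *
              xOf (W := W.baseChange (AlgebraicClosure K)) ((P - Q : geomTorsion W 3) : geomPoints W))) := by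
  rw [← sub_eq_add_neg, sub_neg_eq_add, xOf_coe_neg]
  ring

omit [CharZero K] [W.IsElliptic] in
/-- Relabelling `(P, P + Q)`: `B₁(P,P+Q) = B₂(P,Q)`. [folklore] -/
theorem pairValue_addRight (P Q : geomTorsion W 3) : ((W.baseChange (AlgebraicClosure K)).b₄ -
          3 * (xOf (W := W.baseChange (AlgebraicClosure K)) ((P : geomTorsion W 3) : geomPoints W) *
              xOf (W := W.baseChange (AlgebraicClosure K)) ((P + Q : geomTorsion W 3) : geomPoints W) +
            xOf (W := W.baseChange (AlgebraicClosure K)) ((P + (P + Q) : geomTorsion W 3) : geomPoints W) *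
              xOf (W := W.baseChange (AlgebraicClosure K)) ((P - (P + Q) : geomTorsion W 3) : geomPoints W))) = ((W.baseChange (AlgebraicClosure K)).b₄ -
          3 * (xOf (W := W.baseChange (AlgebraicClosure K)) ((P : geomTorsion W 3) : geomPoints W) *
              xOf (W := W.baseChange (AlgebraicClosure K)) ((P + Q : geomTorsion W 3) : geomPoints W) +
            xOf (W := W.baseChange (AlgebraicClosure K)) ((Q : geomTorsion W 3) : geomPoints W) *
              xOf (W := W.baseChange (AlgebraicClosure K)) ((P - Q : geomTorsion W 3) : geomPoints W))) := by
  have e1 : P + (P + Q) = -(P - Q) := by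
    rw [← add_assoc, add_self_eq_neg_of_three_smul (three_smul_geomTorsion W P)]; abel
  rw [e1, sub_add_cancel_left, xOf_coe_neg, xOf_coe_neg]
  ring

omit [CharZero K] [W.IsElliptic] in
/-- Relabelling `(P, P − Q)`: `B₁(P,P−Q) = B₃(P,Q)`. [folklore] -/
theorem pairValue_subRight (P Q : geomTorsion W 3) : ((W.baseChange (AlgebraicClosure K)).b₄ -
          3 * (xOf (W := W.baseChange (AlgebraicClosure K)) ((P : geomTorsion W 3) : geomPoints W) *
              xOf (W := W.baseChange (AlgebraicClosure K)) ((P - Q : geomTorsion W 3) : geomPoints W) +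
            xOf (W := W.baseChange (AlgebraicClosure K)) ((P + (P - Q) : geomTorsion W 3) : geomPoints W) *
              xOf (W := W.baseChange (AlgebraicClosure K)) ((P - (P - Q) : geomTorsion W 3) : geomPoints W))) = ((W.baseChange (AlgebraicClosure K)).b₄ -
          3 * (xOf (W := W.baseChange (AlgebraicClosure K)) ((P : geomTorsion W 3) : geomPoints W) *
              xOf (W := W.baseChange (AlgebraicClosure K)) ((P - Q : geomTorsion W 3) : geomPoints W) +
            xOf (W := W.baseChange (AlgebraicClosure K)) ((Q : geomTorsion W 3) : geomPoints W) *
              xOf (W := W.baseChange (AlgebraicClosure K)) ((P + Q : geomTorsion W 3) : geomPoints W))) := by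
  have e2 : P + (P - Q) = -(P + Q) := by
    rw [sub_eq_add_neg, ← add_assoc, add_self_eq_neg_of_three_smul (three_smul_geomTorsion W P)]
    abel
  rw [e2, sub_sub_cancel, xOf_coe_neg]
  ring

omit [CharZero K] [W.IsElliptic] in
/-- `Γ_K` acts on the pair value through the points: `σ B₁(P,Q) = B₁(σP,σQ)`. [folklore] -/
theorem smul_pairValue (σ : Field.absoluteGaloisGroup K) (P Q : geomTorsion W 3) :
    σ • ((W.baseChange (AlgebraicClosure K)).b₄ -
          3 * (xOf (W := W.baseChange (AlgebraicClosure K)) ((P : geomTorsion W 3) : geomPoints W) *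
              xOf (W := W.baseChange (AlgebraicClosure K)) ((Q : geomTorsion W 3) : geomPoints W) +
            xOf (W := W.baseChange (AlgebraicClosure K)) ((P + Q : geomTorsion W 3) : geomPoints W) *
              xOf (W := W.baseChange (AlgebraicClosure K)) ((P - Q : geomTorsion W 3) : geomPoints W))) = ((W.baseChange (AlgebraicClosure K)).b₄ -
          3 * (xOf (W := W.baseChange (AlgebraicClosure K)) ((σ • P : geomTorsion W 3) : geomPoints W) *
              xOf (W := W.baseChange (AlgebraicClosure K)) ((σ • Q : geomTorsion W 3) : geomPoints W) +
            xOf (W := W.baseChange (AlgebraicClosure K)) (((σ • P) + (σ • Q) : geomTorsion W 3) : geomPoints W) *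
              xOf (W := W.baseChange (AlgebraicClosure K)) (((σ • P) - (σ • Q) : geomTorsion W 3) : geomPoints W))) := by
  rw [← smul_add σ P Q, ← smul_sub σ P Q]
  simp only [xOf_coe_smul]
  simp only [Field.absoluteGaloisGroup.smul_def, map_sub, map_mul, map_add, map_ofNat, algEquiv_b₄]

/-- **Vieta in the subgroup currency**: for a basis `S, T` of `E[3]` (elements of
`geomTorsion W 3` with `S, T, S + T, S − T ≠ 0`) the abscissae satisfy `b₂ = −3Σx`, `b₄ = Σxx`,
`b₆ = −Σxxx`, `b₈ = 3∏x` on `W_{K̄}` (file F1 `vieta_of_basis`, read on coerced points). [folklore] -/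
theorem vieta_coe {S T : geomTorsion W 3} (h₁ : S ≠ 0) (h₂ : T ≠ 0) (h₃ : S + T ≠ 0)
    (h₄ : S - T ≠ 0) :
    (W.baseChange (AlgebraicClosure K)).b₂ =
      -3 * (xOf (W := W.baseChange (AlgebraicClosure K)) ((S : geomTorsion W 3) : geomPoints W) +
        xOf (W := W.baseChange (AlgebraicClosure K)) ((T : geomTorsion W 3) : geomPoints W) +
        xOf (W := W.baseChange (AlgebraicClosure K)) ((S + T : geomTorsion W 3) : geomPoints W) +
        xOf (W := W.baseChange (AlgebraicClosure K)) ((S - T : geomTorsion W 3) : geomPoints W)) ∧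
    (W.baseChange (AlgebraicClosure K)).b₄ =
      xOf (W := W.baseChange (AlgebraicClosure K)) ((S : geomTorsion W 3) : geomPoints W) *
        xOf (W := W.baseChange (AlgebraicClosure K)) ((T : geomTorsion W 3) : geomPoints W) +
      xOf (W := W.baseChange (AlgebraicClosure K)) ((S : geomTorsion W 3) : geomPoints W) *
        xOf (W := W.baseChange (AlgebraicClosure K)) ((S + T : geomTorsion W 3) : geomPoints W) +
      xOf (W := W.baseChange (AlgebraicClosure K)) ((S : geomTorsion W 3) : geomPoints W) *
        xOf (W := W.baseChange (AlgebraicClosure K)) ((S - T : geomTorsion W 3) : geomPoints W) +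
      xOf (W := W.baseChange (AlgebraicClosure K)) ((T : geomTorsion W 3) : geomPoints W) *
        xOf (W := W.baseChange (AlgebraicClosure K)) ((S + T : geomTorsion W 3) : geomPoints W) +
      xOf (W := W.baseChange (AlgebraicClosure K)) ((T : geomTorsion W 3) : geomPoints W) *
        xOf (W := W.baseChange (AlgebraicClosure K)) ((S - T : geomTorsion W 3) : geomPoints W) +
      xOf (W := W.baseChange (AlgebraicClosure K)) ((S + T : geomTorsion W 3) : geomPoints W) *
        xOf (W := W.baseChange (AlgebraicClosure K)) ((S - T : geomTorsion W 3) : geomPoints W) ∧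
    (W.baseChange (AlgebraicClosure K)).b₆ =
      -(xOf (W := W.baseChange (AlgebraicClosure K)) ((S : geomTorsion W 3) : geomPoints W) *
        xOf (W := W.baseChange (AlgebraicClosure K)) ((T : geomTorsion W 3) : geomPoints W) *
        xOf (W := W.baseChange (AlgebraicClosure K)) ((S + T : geomTorsion W 3) : geomPoints W) +
      xOf (W := W.baseChange (AlgebraicClosure K)) ((S : geomTorsion W 3) : geomPoints W) *
        xOf (W := W.baseChange (AlgebraicClosure K)) ((T : geomTorsion W 3) : geomPoints W) *
        xOf (W := W.baseChange (AlgebraicClosure K)) ((S - T : geomTorsion W 3) : geomPoints W) +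
      xOf (W := W.baseChange (AlgebraicClosure K)) ((S : geomTorsion W 3) : geomPoints W) *
        xOf (W := W.baseChange (AlgebraicClosure K)) ((S + T : geomTorsion W 3) : geomPoints W) *
        xOf (W := W.baseChange (AlgebraicClosure K)) ((S - T : geomTorsion W 3) : geomPoints W) +
      xOf (W := W.baseChange (AlgebraicClosure K)) ((T : geomTorsion W 3) : geomPoints W) *
        xOf (W := W.baseChange (AlgebraicClosure K)) ((S + T : geomTorsion W 3) : geomPoints W) *
        xOf (W := W.baseChange (AlgebraicClosure K)) ((S - T : geomTorsion W 3) : geomPoints W)) ∧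
    (W.baseChange (AlgebraicClosure K)).b₈ =
      3 * (xOf (W := W.baseChange (AlgebraicClosure K)) ((S : geomTorsion W 3) : geomPoints W) *
        xOf (W := W.baseChange (AlgebraicClosure K)) ((T : geomTorsion W 3) : geomPoints W) *
        xOf (W := W.baseChange (AlgebraicClosure K)) ((S + T : geomTorsion W 3) : geomPoints W) *
        xOf (W := W.baseChange (AlgebraicClosure K)) ((S - T : geomTorsion W 3) : geomPoints W)) :=
  vieta_of_basis (W := W.baseChange (AlgebraicClosure K)) (S := (S : geomPoints W))
    (T := (T : geomPoints W)) ((Submodule.mem_torsionBy_iff _ _).mp S.2)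
    ((Submodule.mem_torsionBy_iff _ _).mp T.2) (fun h => h₁ (Subtype.ext h))
    (fun h => h₂ (Subtype.ext h)) (fun h => h₃ (Subtype.ext h)) (fun h => h₄ (Subtype.ext h))

omit [CharZero K] [W.IsElliptic] in
/-- **A non-zero element of `E[3]` has its abscissa killed by `Ψ₃`** (subgroup currency).
[cite: SilvermanAEC2009, Exercise 3.7 (d)] -/
theorem eval_Ψ₃_coe {P : geomTorsion W 3} (hP : P ≠ 0) :
    ((W.baseChange (AlgebraicClosure K)).Ψ₃).eval
      (xOf (W := W.baseChange (AlgebraicClosure K)) ((P : geomTorsion W 3) : geomPoints W)) = 0 :=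
  eval_Ψ₃_xOf_eq_zero (W.baseChange (AlgebraicClosure K)) (P := (P : geomPoints W))
    ((Submodule.mem_torsionBy_iff _ _).mp P.2) (fun h => hP (Subtype.ext h))

/-- **Pair-value facts on a basis, from the normalisation (N).** If `e S T · B₁ = B₂` on every
basis then, on a basis `P, Q`: `B₁ ≠ 0`, `B₂ = e·B₁`, `B₃ = e²·B₁`, `e ≠ 0`, and `B₁³ = Δ`.
[folklore] -/
theorem pairValue_facts {e : geomTorsion W 3 → geomTorsion W 3 → AlgebraicClosure K}
    (hN : ∀ S T : geomTorsion W 3, (S : geomPoints W) ≠ 0 → (T : geomPoints W) ≠ 0 →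
        ((S + T : geomTorsion W 3) : geomPoints W) ≠ 0 →
        ((S - T : geomTorsion W 3) : geomPoints W) ≠ 0 →
        e S T * ((W.baseChange (AlgebraicClosure K)).b₄ -
          3 * (xOf (W := W.baseChange (AlgebraicClosure K)) ((S : geomTorsion W 3) : geomPoints W) *
              xOf (W := W.baseChange (AlgebraicClosure K)) ((T : geomTorsion W 3) : geomPoints W) +
            xOf (W := W.baseChange (AlgebraicClosure K)) ((S + T : geomTorsion W 3) : geomPoints W) *
              xOf (W := W.baseChange (AlgebraicClosure K)) ((S - T : geomTorsion W 3) : geomPoints W))) =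
          ((W.baseChange (AlgebraicClosure K)).b₄ -
          3 * (xOf (W := W.baseChange (AlgebraicClosure K)) ((S : geomTorsion W 3) : geomPoints W) *
              xOf (W := W.baseChange (AlgebraicClosure K)) ((S + T : geomTorsion W 3) : geomPoints W) +
            xOf (W := W.baseChange (AlgebraicClosure K)) ((T : geomTorsion W 3) : geomPoints W) *
              xOf (W := W.baseChange (AlgebraicClosure K)) ((S - T : geomTorsion W 3) : geomPoints W))))
    {P Q : geomTorsion W 3} (h₁ : P ≠ 0) (h₂ : Q ≠ 0) (h₃ : P + Q ≠ 0) (h₄ : P - Q ≠ 0) :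
    ((W.baseChange (AlgebraicClosure K)).b₄ -
          3 * (xOf (W := W.baseChange (AlgebraicClosure K)) ((P : geomTorsion W 3) : geomPoints W) *
              xOf (W := W.baseChange (AlgebraicClosure K)) ((Q : geomTorsion W 3) : geomPoints W) +
            xOf (W := W.baseChange (AlgebraicClosure K)) ((P + Q : geomTorsion W 3) : geomPoints W) *
              xOf (W := W.baseChange (AlgebraicClosure K)) ((P - Q : geomTorsion W 3) : geomPoints W))) ≠ 0 ∧ ((W.baseChange (AlgebraicClosure K)).b₄ -
          3 * (xOf (W := W.baseChange (AlgebraicClosure K)) ((P : geomTorsion W 3) : geomPoints W) *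
              xOf (W := W.baseChange (AlgebraicClosure K)) ((P + Q : geomTorsion W 3) : geomPoints W) +
            xOf (W := W.baseChange (AlgebraicClosure K)) ((Q : geomTorsion W 3) : geomPoints W) *
              xOf (W := W.baseChange (AlgebraicClosure K)) ((P - Q : geomTorsion W 3) : geomPoints W))) = e P Q * ((W.baseChange (AlgebraicClosure K)).b₄ -
          3 * (xOf (W := W.baseChange (AlgebraicClosure K)) ((P : geomTorsion W 3) : geomPoints W) *
              xOf (W := W.baseChange (AlgebraicClosure K)) ((Q : geomTorsion W 3) : geomPoints W) +
            xOf (W := W.baseChange (AlgebraicClosure K)) ((P + Q : geomTorsion W 3) : geomPoints W) *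
              xOf (W := W.baseChange (AlgebraicClosure K)) ((P - Q : geomTorsion W 3) : geomPoints W))) ∧ ((W.baseChange (AlgebraicClosure K)).b₄ -
          3 * (xOf (W := W.baseChange (AlgebraicClosure K)) ((P : geomTorsion W 3) : geomPoints W) *
              xOf (W := W.baseChange (AlgebraicClosure K)) ((P - Q : geomTorsion W 3) : geomPoints W) +
            xOf (W := W.baseChange (AlgebraicClosure K)) ((Q : geomTorsion W 3) : geomPoints W) *
              xOf (W := W.baseChange (AlgebraicClosure K)) ((P + Q : geomTorsion W 3) : geomPoints W))) = e P Q ^ 2 * ((W.baseChange (AlgebraicClosure K)).b₄ -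
          3 * (xOf (W := W.baseChange (AlgebraicClosure K)) ((P : geomTorsion W 3) : geomPoints W) *
              xOf (W := W.baseChange (AlgebraicClosure K)) ((Q : geomTorsion W 3) : geomPoints W) +
            xOf (W := W.baseChange (AlgebraicClosure K)) ((P + Q : geomTorsion W 3) : geomPoints W) *
              xOf (W := W.baseChange (AlgebraicClosure K)) ((P - Q : geomTorsion W 3) : geomPoints W))) ∧ e P Q ≠ 0 ∧
      ((W.baseChange (AlgebraicClosure K)).b₄ -
          3 * (xOf (W := W.baseChange (AlgebraicClosure K)) ((P : geomTorsion W 3) : geomPoints W) *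
              xOf (W := W.baseChange (AlgebraicClosure K)) ((Q : geomTorsion W 3) : geomPoints W) +
            xOf (W := W.baseChange (AlgebraicClosure K)) ((P + Q : geomTorsion W 3) : geomPoints W) *
              xOf (W := W.baseChange (AlgebraicClosure K)) ((P - Q : geomTorsion W 3) : geomPoints W))) ^ 3 = (W.baseChange (AlgebraicClosure K)).Δ := by
  have ne : ∀ {R : geomTorsion W 3}, R ≠ 0 → (R : geomPoints W) ≠ 0 :=
    fun hR h => hR (Subtype.ext h)
  have m3 : ∀ R : geomTorsion W 3, (3 : ℤ) • (R : geomPoints W) = 0 :=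
    fun R => (Submodule.mem_torsionBy_iff _ _).mp R.2
  obtain ⟨hB₁, hB₂, -, c1, -, -, -, -, -, -, -, -, -, -, -, w4⟩ :=
    cubeRoots_of_sum_eq_zero
      (pairValues_sum_eq_zero (W := W.baseChange (AlgebraicClosure K)) (S := (P : geomPoints W))
        (T := (Q : geomPoints W)) (m3 P) (m3 Q) (ne h₁) (ne h₂) (ne h₃) (ne h₄))
      (pairValues_sum_mul_eq_zero (W := W.baseChange (AlgebraicClosure K)) (S := (P : geomPoints W))
        (T := (Q : geomPoints W)) (m3 P) (m3 Q) (ne h₁) (ne h₂) (ne h₃) (ne h₄))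
      (pairValues_prod_eq_Δ (W := W.baseChange (AlgebraicClosure K)) (S := (P : geomPoints W))
        (T := (Q : geomPoints W)) (m3 P) (m3 Q) (ne h₁) (ne h₂) (ne h₃) (ne h₄))
      (W.baseChange (AlgebraicClosure K)).isUnit_Δ.ne_zero
  -- the same facts, read in the subgroup currency (definitionally equal)
  have hB₁' : ((W.baseChange (AlgebraicClosure K)).b₄ -
          3 * (xOf (W := W.baseChange (AlgebraicClosure K)) ((P : geomTorsion W 3) : geomPoints W) *
              xOf (W := W.baseChange (AlgebraicClosure K)) ((Q : geomTorsion W 3) : geomPoints W) +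
            xOf (W := W.baseChange (AlgebraicClosure K)) ((P + Q : geomTorsion W 3) : geomPoints W) *
              xOf (W := W.baseChange (AlgebraicClosure K)) ((P - Q : geomTorsion W 3) : geomPoints W))) ≠ 0 := hB₁
  have hB₂' : ((W.baseChange (AlgebraicClosure K)).b₄ -
          3 * (xOf (W := W.baseChange (AlgebraicClosure K)) ((P : geomTorsion W 3) : geomPoints W) *
              xOf (W := W.baseChange (AlgebraicClosure K)) ((P + Q : geomTorsion W 3) : geomPoints W) +
            xOf (W := W.baseChange (AlgebraicClosure K)) ((Q : geomTorsion W 3) : geomPoints W) *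
              xOf (W := W.baseChange (AlgebraicClosure K)) ((P - Q : geomTorsion W 3) : geomPoints W))) ≠ 0 := hB₂
  have c1' : ((W.baseChange (AlgebraicClosure K)).b₄ -
          3 * (xOf (W := W.baseChange (AlgebraicClosure K)) ((P : geomTorsion W 3) : geomPoints W) *
              xOf (W := W.baseChange (AlgebraicClosure K)) ((Q : geomTorsion W 3) : geomPoints W) +
            xOf (W := W.baseChange (AlgebraicClosure K)) ((P + Q : geomTorsion W 3) : geomPoints W) *
              xOf (W := W.baseChange (AlgebraicClosure K)) ((P - Q : geomTorsion W 3) : geomPoints W))) ^ 3 = (W.baseChange (AlgebraicClosure K)).Δ := c1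
  have w4' : ((W.baseChange (AlgebraicClosure K)).b₄ -
          3 * (xOf (W := W.baseChange (AlgebraicClosure K)) ((P : geomTorsion W 3) : geomPoints W) *
              xOf (W := W.baseChange (AlgebraicClosure K)) ((P - Q : geomTorsion W 3) : geomPoints W) +
            xOf (W := W.baseChange (AlgebraicClosure K)) ((Q : geomTorsion W 3) : geomPoints W) *
              xOf (W := W.baseChange (AlgebraicClosure K)) ((P + Q : geomTorsion W 3) : geomPoints W))) / ((W.baseChange (AlgebraicClosure K)).b₄ -
          3 * (xOf (W := W.baseChange (AlgebraicClosure K)) ((P : geomTorsion W 3) : geomPoints W) *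
              xOf (W := W.baseChange (AlgebraicClosure K)) ((Q : geomTorsion W 3) : geomPoints W) +
            xOf (W := W.baseChange (AlgebraicClosure K)) ((P + Q : geomTorsion W 3) : geomPoints W) *
              xOf (W := W.baseChange (AlgebraicClosure K)) ((P - Q : geomTorsion W 3) : geomPoints W))) = (((W.baseChange (AlgebraicClosure K)).b₄ -
          3 * (xOf (W := W.baseChange (AlgebraicClosure K)) ((P : geomTorsion W 3) : geomPoints W) *
              xOf (W := W.baseChange (AlgebraicClosure K)) ((P + Q : geomTorsion W 3) : geomPoints W) +
            xOf (W := W.baseChange (AlgebraicClosure K)) ((Q : geomTorsion W 3) : geomPoints W) *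
              xOf (W := W.baseChange (AlgebraicClosure K)) ((P - Q : geomTorsion W 3) : geomPoints W))) / ((W.baseChange (AlgebraicClosure K)).b₄ -
          3 * (xOf (W := W.baseChange (AlgebraicClosure K)) ((P : geomTorsion W 3) : geomPoints W) *
              xOf (W := W.baseChange (AlgebraicClosure K)) ((Q : geomTorsion W 3) : geomPoints W) +
            xOf (W := W.baseChange (AlgebraicClosure K)) ((P + Q : geomTorsion W 3) : geomPoints W) *
              xOf (W := W.baseChange (AlgebraicClosure K)) ((P - Q : geomTorsion W 3) : geomPoints W)))) ^ 2 := w4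
  have hNPQ := hN P Q (ne h₁) (ne h₂) (ne h₃) (ne h₄)
  have he : e P Q = ((W.baseChange (AlgebraicClosure K)).b₄ -
          3 * (xOf (W := W.baseChange (AlgebraicClosure K)) ((P : geomTorsion W 3) : geomPoints W) *
              xOf (W := W.baseChange (AlgebraicClosure K)) ((P + Q : geomTorsion W 3) : geomPoints W) +
            xOf (W := W.baseChange (AlgebraicClosure K)) ((Q : geomTorsion W 3) : geomPoints W) *
              xOf (W := W.baseChange (AlgebraicClosure K)) ((P - Q : geomTorsion W 3) : geomPoints W))) / ((W.baseChange (AlgebraicClosure K)).b₄ -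
          3 * (xOf (W := W.baseChange (AlgebraicClosure K)) ((P : geomTorsion W 3) : geomPoints W) *
              xOf (W := W.baseChange (AlgebraicClosure K)) ((Q : geomTorsion W 3) : geomPoints W) +
            xOf (W := W.baseChange (AlgebraicClosure K)) ((P + Q : geomTorsion W 3) : geomPoints W) *
              xOf (W := W.baseChange (AlgebraicClosure K)) ((P - Q : geomTorsion W 3) : geomPoints W))) := by
    rw [eq_div_iff hB₁']; exact hNPQ
  refine ⟨hB₁', hNPQ.symm, ?_, by rw [he]; exact div_ne_zero hB₂' hB₁', c1'⟩
  rw [he, ← w4', div_mul_cancel₀ _ hB₁']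

end Relabel

/-! ### §5. Invariance and descent; bases under isomorphisms -/

section Moves

variable (W W' : WeierstrassCurve K) [W.IsElliptic] [W'.IsElliptic]

/-- The INVARIANCE-AND-DESCENT core, for a function of bases of `E′[3]` built from the pair values:
if `c` is invariant under the five moves and `Γ_K` acts on it through the points, its value at a
basis lies in `K`. [folklore] -/
theorem exists_algebraMap_eq_of_moves (c : geomTorsion W' 3 → geomTorsion W' 3 → AlgebraicClosure K)
    (I1 : ∀ P Q : geomTorsion W' 3, P ≠ 0 → Q ≠ 0 → P + Q ≠ 0 → P - Q ≠ 0 → c Q P = c P Q)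
    (I2 : ∀ P Q : geomTorsion W' 3, P ≠ 0 → Q ≠ 0 → P + Q ≠ 0 → P - Q ≠ 0 → c (-P) Q = c P Q)
    (I3 : ∀ P Q : geomTorsion W' 3, P ≠ 0 → Q ≠ 0 → P + Q ≠ 0 → P - Q ≠ 0 → c P (-Q) = c P Q)
    (I4 : ∀ P Q : geomTorsion W' 3, P ≠ 0 → Q ≠ 0 → P + Q ≠ 0 → P - Q ≠ 0 → c P (P + Q) = c P Q)
    (I5 : ∀ P Q : geomTorsion W' 3, P ≠ 0 → Q ≠ 0 → P + Q ≠ 0 → P - Q ≠ 0 → c P (P - Q) = c P Q)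
    (hσ : ∀ (σ : Field.absoluteGaloisGroup K) (P Q : geomTorsion W' 3), P ≠ 0 → Q ≠ 0 → P + Q ≠ 0 →
      P - Q ≠ 0 → σ • c P Q = c (σ • P) (σ • Q))
    {S₀ T₀ : geomTorsion W' 3} (h₁ : S₀ ≠ 0) (h₂ : T₀ ≠ 0) (h₃ : S₀ + T₀ ≠ 0) (h₄ : S₀ - T₀ ≠ 0) :
    ∃ k : K, algebraMap K (AlgebraicClosure K) k = c S₀ T₀ := by
  haveI : IsGalois K (AlgebraicClosure K) := {}
  have hconst : ∀ P Q : geomTorsion W' 3, P ≠ 0 → Q ≠ 0 → P + Q ≠ 0 → P - Q ≠ 0 →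
      c P Q = c S₀ T₀ := fun P Q hP hQ hPQ hPQ' =>
    const_of_moves c (three_smul_geomTorsion W')
      (fun P Q hP hQ hPQ hPQ' R => geomTorsion_three_eq_of_basis W' hP hQ hPQ hPQ' R)
      I1 I2 I3 I4 I5 h₁ h₂ h₃ h₄ hP hQ hPQ hPQ'
  refine (InfiniteGalois.mem_range_algebraMap_iff_fixed (c S₀ T₀)).mpr fun g => ?_
  -- `g : K̄ ≃ₐ[K] K̄` read as an element `σ` of `Field.absoluteGaloisGroup K` (the same type)
  set σ : Field.absoluteGaloisGroup K := (Field.absoluteGaloisGroup.toAlgEquiv K).symm g with hσg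
  have hne : ∀ {P : geomTorsion W' 3}, P ≠ 0 → σ • P ≠ 0 := fun hP h =>
    hP ((smul_eq_zero_iff_eq σ).mp h)
  have e := hσ σ S₀ T₀ h₁ h₂ h₃ h₄
  rw [hconst (σ • S₀) (σ • T₀) (hne h₁) (hne h₂) (by rw [← smul_add]; exact hne h₃)
    (by rw [← smul_sub]; exact hne h₄)] at e
  exact e

omit [CharZero K] [W.IsElliptic] [W'.IsElliptic] in
/-- Bases of `E′[3]` go to bases of `E[3]` under an additive isomorphism. [folklore] -/
theorem basis_map (θ : geomTorsion W' 3 ≃+ geomTorsion W 3) {P Q : geomTorsion W' 3} (hP : P ≠ 0)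
    (hQ : Q ≠ 0) (hPQ : P + Q ≠ 0) (hPQ' : P - Q ≠ 0) :
    θ P ≠ 0 ∧ θ Q ≠ 0 ∧ θ P + θ Q ≠ 0 ∧ θ P - θ Q ≠ 0 := by
  refine ⟨(AddEquiv.map_ne_zero_iff θ).mpr hP, (AddEquiv.map_ne_zero_iff θ).mpr hQ, ?_, ?_⟩
  · rw [← map_add]; exact (AddEquiv.map_ne_zero_iff θ).mpr hPQ
  · rw [← map_sub]; exact (AddEquiv.map_ne_zero_iff θ).mpr hPQ'


end Moves

end Summit.BirchSwinnertonDyer.Rank1Residual.GaloisImage.CubeRootPairing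

end
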